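import Summits.QuantumFields.BalabanUV.T4Continuum.Support.NE3HessBounds
import HarnessLib

/-!
# NE7 — THE SECOND VARIATION OF THE TRACE LINK FUNCTIONAL ALONG A ONE-PARAMETER GAUGE SUBGROUP: for a link `L` conjugated by `e^{ta}` on
# the left and `e^{−tc}` on the right, `t ↦ 1 − Re tr(e^{ta} L e^{−tc})∕n` has first derivative `−Re tr(aM − Mc)∕n` and second derivative
# `−Re tr(a(aM − Mc) − (aM − Mc)c)∕n` (`M = e^{ta}Le^{−tc}`), and the latter is BOUNDED BELOW by
# `‖c − a‖²_{HS}∕n − ‖M − 1‖·‖c − a‖² − ½|Re tr((M − Mᴴ)[a, c − a])∕n|` for skew `a, c` (F310)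

Cell `pub-balaban`, rung (B)+1 sub-cell t4, lineage `b2b-balaban-t4-ne7-p1` (CRUX PROVER NE7 #1 = OWNER of row NE7), generation 93; memo
`t4/b2b-balaban-t4-ne7-p1-g93/UHLENBECK-ROAD.md` §3.  The calculus brick of the EXISTENCE half of the one-scale lattice Uhlenbeck lemma by
INCREMENTAL MINIMISATION (road U-IM): at each step of the deformation `s ↦ e^{sB}` of a box configuration, the next free-boundary Landau gauge is
the minimiser of the trace link functional over a small ball of pinned unitary gauges; the ball's boundary is excluded by the CONVEXITY of the
functional along one-parameter subgroups `t ↦ e^{tη}g` — this file computes that second derivative bond by bond and isolates its positive part.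

THE KEY IDENTITY (§1).  `Re tr(a(aM − Mc) − (aM − Mc)c) = Re tr(M(c − a)²) + Re tr(M[a, c − a])` (cyclicity kills `Re tr(a²M) − Re tr(Ma²)` and
`Re tr(aMc) − Re tr(Mca)`): the `O(‖a‖²)` terms CANCEL, leaving the bond difference `δ = c − a` squared (the lattice Dirichlet form, positive:
`−Re tr(δ²)∕n = ‖δ‖²_{HS}∕n ≥ ‖δ‖²∕n` for skew `δ`) plus a commutator term `Re tr(M[a,δ])`, which only sees the ODD part `M − Mᴴ` of the link
(`Re tr(WK) = ½Re tr((W − Wᴴ)K)` for skew `K`) — small at a small-field gauge.  Downstream (F311) the commutator term is split into its mean-zero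
part (box Poincaré) and its mean part (the Euler–Lagrange expression).

WHAT ([folklore] matrix calculus; 0 def, 0 sorry):
* §1 `conjTranspose_comm_skew`, **`nReTr_secondVar_eq`**, `nReTr_mul_skew_eq_half`, **`secondVar_lower`**.
* §2 `hasDerivAt_expConj` (`d∕dt e^{ta}Le^{−tc} = aM − Mc` at every `t`), `hasDerivAt_one_sub_nReTr_expConj`, **`hasDerivAt_nReTr_firstVar`**
  (the derivative of `t ↦ −Re tr(aM_t − M_tc)∕n` is `−Re tr(a(aM_t − M_tc) − (aM_t − M_tc)c)∕n`).
* §3 `hasDerivAt_sum_ite` — finite indicator-weighted sums of the above (the shape of the free-boundary trace functional on a box).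
HONEST FRAMING (page 1): elementary matrix analysis; nothing of Bałaban's asserted; NE7 NOT PROVED here; spine 0∕9; finite T⁴ rung (B)+1 — NOT
infinite volume, NOT mass gap, NOT `BetaPertH`, NOT Clay.  No `sorry`; axioms ⊆ {propext, Classical.choice, Quot.sound}.
-/

set_option autoImplicit false

open scoped BigOperators Matrix Matrix.Norms.L2Operator
open Finset NormedSpace

namespace Summit.QuantumFields.BalabanUV.T4Continuum.NE7TraceLinkSecondVariation

open Literature.MathematicalPhysics.QuantumFieldTheory.Balaban1983to89
open UnitaryModel MatrixNorms
open T4AveragingDeficitWall (nReTrL nReTrL_apply)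
open NE3HessBounds (nReTr_mul_comm nReTr_neg' neg_nReTr_mul_self_of_skew opNorm_sq_div_card_le_nhsNormSq)
open AveragingDeficitNearIdentity (abs_nReTr_mul_le)
open T4TiltOscillation (nReTr_add nReTr_sub)

noncomputable section

variable {n : Type*} [Fintype n] [DecidableEq n]

/-! ## §1 Trace algebra of the second variation -/

omit [DecidableEq n] in
/-- The commutator of two skew-adjoint matrices is skew-adjoint: `(aδ − δa)ᴴ = −(aδ − δa)`. [folklore] -/
theorem conjTranspose_comm_skew {a δ : Matrix n n ℂ} (ha : a ∈ skewAdjoint (Matrix n n ℂ)) (hδ : δ ∈ skewAdjoint (Matrix n n ℂ)) :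
    (a * δ - δ * a)ᴴ = -(a * δ - δ * a) := by
  have ha' : aᴴ = -a := by rw [← Matrix.star_eq_conjTranspose]; exact skewAdjoint.mem_iff.1 ha
  have hδ' : δᴴ = -δ := by rw [← Matrix.star_eq_conjTranspose]; exact skewAdjoint.mem_iff.1 hδ
  rw [Matrix.conjTranspose_sub, Matrix.conjTranspose_mul, Matrix.conjTranspose_mul, ha', hδ']
  noncomm_ring

omit [DecidableEq n] in
/-- **THE KEY IDENTITY OF THE SECOND VARIATION**: `Re tr(a(aM − Mc) − (aM − Mc)c) = Re tr(M(c−a)²) + Re tr(M(a(c−a) − (c−a)a))` — the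
`O(‖a‖²)` terms cancel by cyclicity of the trace. [folklore] -/
theorem nReTr_secondVar_eq (a c M : Matrix n n ℂ) :
    nReTr (a * (a * M - M * c) - (a * M - M * c) * c)
      = nReTr (M * ((c - a) * (c - a))) + nReTr (M * (a * (c - a) - (c - a) * a)) := by
  have h1 : nReTr (a * (a * M)) = nReTr (M * a * a) := by
    rw [nReTr_mul_comm a (a * M), nReTr_mul_comm (M * a) a, mul_assoc]
  have h2 : nReTr (a * (M * c)) = nReTr (M * c * a) := by rw [nReTr_mul_comm a (M * c)]
  have eL : a * (a * M - M * c) - (a * M - M * c) * c = a * (a * M) - a * (M * c) - a * (M * c) + M * c * c := by noncomm_ring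
  have eR1 : M * ((c - a) * (c - a)) = M * c * c - M * c * a - M * a * c + M * a * a := by noncomm_ring
  have eR2 : M * (a * (c - a) - (c - a) * a) = M * a * c - M * c * a := by noncomm_ring
  rw [eL, eR1, eR2]
  simp only [nReTr_add, nReTr_sub, h1, h2]
  have h3 : nReTr (a * (M * c)) = nReTr (M * c * a) := h2
  ring

omit [DecidableEq n] in
/-- **A LINK PAIRED WITH A SKEW MATRIX ONLY SEES ITS ODD PART**: `Re tr(WK) = ½·Re tr((W − Wᴴ)K)` for `Kᴴ = −K`. [folklore] -/
theorem nReTr_mul_skew_eq_half (W K : Matrix n n ℂ) (hK : Kᴴ = -K) :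
    nReTr (W * K) = (1 / 2) * nReTr ((W - Wᴴ) * K) := by
  have h : nReTr (Wᴴ * K) = -nReTr (W * K) := by
    rw [← nReTr_conjTranspose (Wᴴ * K), Matrix.conjTranspose_mul, Matrix.conjTranspose_conjTranspose, hK, nReTr_mul_comm,
      mul_neg, nReTr_neg']
  rw [sub_mul, nReTr_sub, h]; ring

/-- **THE POSITIVE PART OF THE SECOND VARIATION**: for skew `a, c` and any link `M`,
`‖c−a‖²_{HS}∕n − ‖M − 1‖·‖c − a‖² − ½·|Re tr((M − Mᴴ)(a(c−a) − (c−a)a))∕n| ≤ −Re tr(a(aM − Mc) − (aM − Mc)c)∕n`. [folklore] -/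
theorem secondVar_lower (a c M : Matrix n n ℂ) (ha : a ∈ skewAdjoint (Matrix n n ℂ)) (hc : c ∈ skewAdjoint (Matrix n n ℂ)) :
    nhsNormSq (c - a) - ‖M - 1‖ * ‖c - a‖ ^ 2 - (1 / 2) * |nReTr ((M - Mᴴ) * (a * (c - a) - (c - a) * a))|
      ≤ -nReTr (a * (a * M - M * c) - (a * M - M * c) * c) := by
  have hδ : c - a ∈ skewAdjoint (Matrix n n ℂ) := (skewAdjoint (Matrix n n ℂ)).sub_mem hc ha
  rw [nReTr_secondVar_eq]
  -- the Dirichlet term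
  have h1 : nReTr (M * ((c - a) * (c - a))) = nReTr ((c - a) * (c - a)) + nReTr ((M - 1) * ((c - a) * (c - a))) := by
    rw [← nReTr_add]; congr 1; noncomm_ring
  have h2 : -nReTr ((c - a) * (c - a)) = nhsNormSq (c - a) := neg_nReTr_mul_self_of_skew hδ
  have h3 : |nReTr ((M - 1) * ((c - a) * (c - a)))| ≤ ‖M - 1‖ * ‖c - a‖ ^ 2 := by
    calc _ ≤ ‖M - 1‖ * ‖(c - a) * (c - a)‖ := abs_nReTr_mul_le _ _
      _ ≤ ‖M - 1‖ * (‖c - a‖ * ‖c - a‖) := mul_le_mul_of_nonneg_left (norm_mul_le _ _) (norm_nonneg _)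
      _ = ‖M - 1‖ * ‖c - a‖ ^ 2 := by ring
  -- the commutator term sees only the odd part
  have h4 : nReTr (M * (a * (c - a) - (c - a) * a)) = (1 / 2) * nReTr ((M - Mᴴ) * (a * (c - a) - (c - a) * a)) :=
    nReTr_mul_skew_eq_half M _ (conjTranspose_comm_skew ha hδ)
  rw [h1, h4]
  have h5 := (abs_le.1 h3).2
  have h6 := le_abs_self (nReTr ((M - Mᴴ) * (a * (c - a) - (c - a) * a)))
  linarith

/-! ## §2 Derivatives along `t ↦ e^{ta} L e^{−tc}` -/

/-- **THE CONJUGATED LINK IS DIFFERENTIABLE AT EVERY TIME**: `d∕dt (e^{ta}Le^{−tc}) = a·M_t − M_t·c`, `M_t = e^{ta}Le^{−tc}`. [folklore] -/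
theorem hasDerivAt_expConj (a c L : Matrix n n ℂ) (t₀ : ℝ) :
    HasDerivAt (fun t : ℝ => exp ((t : ℂ) • a) * L * exp (-((t : ℂ) • c)))
      (a * (exp ((t₀ : ℂ) • a) * L * exp (-((t₀ : ℂ) • c))) - (exp ((t₀ : ℂ) • a) * L * exp (-((t₀ : ℂ) • c))) * c) t₀ := by
  have h1 := hasDerivAt_exp_smul_const' (𝕂 := ℝ) a t₀
  have h2 := hasDerivAt_exp_smul_const (𝕂 := ℝ) (-c) t₀
  have h3 := (h1.mul_const L).mul h2
  have hfun : (fun t : ℝ => exp ((t : ℂ) • a) * L * exp (-((t : ℂ) • c))) = fun t : ℝ => exp (t • a) * L * exp (t • (-c)) := by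
    funext t; simp only [Complex.coe_smul, smul_neg]
  rw [hfun]
  refine h3.congr_deriv ?_
  simp only [Complex.coe_smul, smul_neg]
  noncomm_ring

/-- The bond weight `t ↦ 1 − Re tr(e^{ta}Le^{−tc})∕n` has derivative `−Re tr(aM_t − M_tc)∕n` at every `t`. [folklore] -/
theorem hasDerivAt_one_sub_nReTr_expConj (a c L : Matrix n n ℂ) (t₀ : ℝ) :
    HasDerivAt (fun t : ℝ => 1 - nReTr (exp ((t : ℂ) • a) * L * exp (-((t : ℂ) • c))))
      (-nReTr (a * (exp ((t₀ : ℂ) • a) * L * exp (-((t₀ : ℂ) • c))) - (exp ((t₀ : ℂ) • a) * L * exp (-((t₀ : ℂ) • c))) * c)) t₀ := by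
  have h := ((nReTrL (n := n)).hasFDerivAt.comp_hasDerivAt t₀ (hasDerivAt_expConj a c L t₀)).const_sub 1
  simpa [Function.comp_def] using h

/-- **THE DERIVATIVE OF THE FIRST VARIATION**: `t ↦ −Re tr(aM_t − M_tc)∕n` has derivative `−Re tr(a(aM_t − M_tc) − (aM_t − M_tc)c)∕n`. [folklore] -/
theorem hasDerivAt_nReTr_firstVar (a c L : Matrix n n ℂ) (t₀ : ℝ) :
    HasDerivAt (fun t : ℝ => -nReTr (a * (exp ((t : ℂ) • a) * L * exp (-((t : ℂ) • c))) - (exp ((t : ℂ) • a) * L * exp (-((t : ℂ) • c))) * c))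
      (-nReTr (a * (a * (exp ((t₀ : ℂ) • a) * L * exp (-((t₀ : ℂ) • c))) - (exp ((t₀ : ℂ) • a) * L * exp (-((t₀ : ℂ) • c))) * c)
        - (a * (exp ((t₀ : ℂ) • a) * L * exp (-((t₀ : ℂ) • c))) - (exp ((t₀ : ℂ) • a) * L * exp (-((t₀ : ℂ) • c))) * c) * c)) t₀ := by
  have hM := hasDerivAt_expConj a c L t₀
  have h1 : HasDerivAt (fun t : ℝ => a * (exp ((t : ℂ) • a) * L * exp (-((t : ℂ) • c))) - (exp ((t : ℂ) • a) * L * exp (-((t : ℂ) • c))) * c)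
      (a * (a * (exp ((t₀ : ℂ) • a) * L * exp (-((t₀ : ℂ) • c))) - (exp ((t₀ : ℂ) • a) * L * exp (-((t₀ : ℂ) • c))) * c)
        - (a * (exp ((t₀ : ℂ) • a) * L * exp (-((t₀ : ℂ) • c))) - (exp ((t₀ : ℂ) • a) * L * exp (-((t₀ : ℂ) • c))) * c) * c) t₀ :=
    (hM.const_mul a).sub (hM.mul_const c)
  have h2 := ((nReTrL (n := n)).hasFDerivAt.comp_hasDerivAt t₀ h1).neg
  simpa [Function.comp_def, Pi.neg_def] using h2

/-! ## §3 Indicator-weighted finite sums -/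

/-- **FINITE INDICATOR-WEIGHTED SUMS** (the shape of the free-boundary trace functional on a box and of its variations): if each summand has a
derivative, so does `t ↦ Σ_i 𝟙(p_i)·f_i(t)`, with derivative `Σ_i 𝟙(p_i)·f_i′(t)`. [folklore] -/
theorem hasDerivAt_sum_ite {ι : Type*} (s : Finset ι) (p : ι → Prop) [DecidablePred p] {f : ι → ℝ → ℝ} {f' : ι → ℝ} {t₀ : ℝ}
    (hf : ∀ i ∈ s, p i → HasDerivAt (f i) (f' i) t₀) :
    HasDerivAt (fun t : ℝ => ∑ i ∈ s, (if p i then f i t else 0)) (∑ i ∈ s, (if p i then f' i else 0)) t₀ := by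
  refine HasDerivAt.fun_sum fun i hi => ?_
  by_cases hp : p i
  · simp only [hp, if_true]; exact hf i hi hp
  · simp only [hp, if_false]; exact hasDerivAt_const t₀ 0

end

end Summit.QuantumFields.BalabanUV.T4Continuum.NE7TraceLinkSecondVariation
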